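import Literature.NumberTheory.LFunctions.PrimesInQuarterInterval
import HarnessLib

/-!
# Many primes in a window `(x, 4x]` (Chebyshev-strength substitute for Ford's Lemma 2.1)

Topic `Literature/NumberTheory/LFunctions`.  Everything in this file is PROVED; no definition and
no named fact is introduced.

K. Ford, *Vinogradov's integral and bounds for the Riemann zeta function*, Proc. LMS 85 (2002),
Lemma 2.1 ("if `N > 20` and `x ≥ 2N log N` there are at least `N` primes in `(x, 2x]`; …") rests on
the Rosser–Schoenfeld bounds (2.1) for `π(x)`, which are not in the tree.  From the Chebyshev bounds
of Mathlib (through `PrimeInterval.card_quarterPrimes_ge`: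
`#{y/4 < p ≤ y} ≥ (log 2/8) y/log y` for `y ≥ 10¹²`) one gets the same kind of statement with the
window `(x, 2x]` replaced by `(x, 4x]` and an explicit (larger) threshold:

* `FordVK.le_card_quarterPrimes` — if `y ≥ 10¹²` and `12 n log y ≤ y` then there are at least `n`
  primes in `(y/4, y]`.

This is the prime-number input of the iterations of Ford's Lemma 3.4 (`k³` primes in `(M, ηM]`,
there with `η = 1 + ω ≤ 3/2`) and Lemma 6.5, at the price `η = 4` in the constants
`η^{4s+k²}`, `η^{k²-Δ}`.

## References

* K. Ford, *Vinogradov's integral and bounds for the Riemann zeta function*, Proc. London Math.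
  Soc. (3) 85 (2002), 565–633; arXiv:1910.08209. Lemma 2.1 (statement replaced as described).
  [Ford2002]
* P. L. Chebyshev (1852); Mathlib `Mathlib.NumberTheory.Chebyshev`, via
  `PrimesInQuarterInterval.lean`. [folklore]
-/

open Finset Real

namespace Literature.NumberTheory.LFunctions
namespace FordVK

open PrimeInterval

/-- **At least `n` primes in `(y/4, y]`** when `y ≥ 10¹²` and `12 n log y ≤ y`.
[cite: Ford2002, Lemma 2.1 (Chebyshev-strength substitute: window `(x,4x]`, threshold `10¹²`)] -/
theorem le_card_quarterPrimes {n : ℕ} {y : ℝ} (hy : (10 : ℝ) ^ 12 ≤ y)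
    (hn : 12 * (n : ℝ) * Real.log y ≤ y) : n ≤ (quarterPrimes y).card := by
  have hy1 : (1 : ℝ) < y := lt_of_lt_of_le (by norm_num) hy
  have hlogy : 0 < Real.log y := Real.log_pos hy1
  have h1 := card_quarterPrimes_ge hy
  have hlog2 : 0.6931471803 < Real.log 2 := Real.log_two_gt_d9
  have h2 : 12 * (n : ℝ) ≤ y / Real.log y := by rwa [le_div_iff₀ hlogy]
  have h3 : (n : ℝ) ≤ Real.log 2 / 8 * y / Real.log y := by
    rw [mul_div_assoc]
    nlinarith [div_nonneg (by linarith : (0 : ℝ) ≤ y) hlogy.le]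
  exact_mod_cast h3.trans h1

/-- The same with the window written as `(x, 4x]`: for `x ≥ 10¹²/4` and `12 n log(4x) ≤ 4x` there
are at least `n` primes `p` with `x < p ≤ 4x`. [cite: Ford2002, Lemma 2.1 (substitute)] -/
theorem le_card_primes_Ioc_four_mul {n : ℕ} {x : ℝ} (hx : (10 : ℝ) ^ 12 / 4 ≤ x)
    (hn : 12 * (n : ℝ) * Real.log (4 * x) ≤ 4 * x) :
    n ≤ ((Nat.primesLE ⌊4 * x⌋₊).filter fun p : ℕ => x < (p : ℝ)).card := by
  have h := le_card_quarterPrimes (y := 4 * x) (by linarith) hn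
  refine h.trans (Finset.card_le_card fun p hp => ?_)
  rw [mem_quarterPrimes] at hp
  rw [Finset.mem_filter, Nat.mem_primesLE]
  refine ⟨⟨Nat.le_floor hp.2.2, hp.1⟩, ?_⟩
  linarith [hp.2.1]

end FordVK
end Literature.NumberTheory.LFunctions
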